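import Summits.QuantumFields.BalabanUV.Beta.WilsonBackgroundWard22All
import Literature.MathematicalPhysics.QuantumFieldTheory.Balaban1983to89.Beta.PlaquetteBackground

/-!
# The BACKGROUND-gauge Ward identity of the Wilson plaquette jets at order `(W², B¹)`; part 5: POINT FORM

Fifth file of (bgW₂) — READ THE HEADER of `Summits/QuantumFields/BalabanUV/Beta/WilsonBackgroundWard22.lean` (setting, provenance, honest
framing, what is NOT done).  THIS FILE specialises part 4's lattice identity `WilsonBackgroundWard22All.jet22_bgWard` to the data an
entrywise (stencil) reading starts from: ONE background bond letter `B = bondLetter u′ λ′ Y′` (an3's `PlaquetteVertex.bondLetter`) and the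
SITE-DELTA gauge parameter `λ = (y ↦ [y = u]·Y)`.  Then

* the pure-gauge background `gaugeDir₀ e λ` lives on the bonds touching `u` (`gaugeDir₀_site`), the base-point conjugation `adj λ W` on
  the bonds starting at `u` (`adj_site`);
* the rotated-letter background of part 4, `(λ(b₋) + λ(b₊))·B_b − B_b·(λ(b₋) + λ(b₊))`, COLLAPSES to the same bond `(u′, λ′)` with the
  letter `[Y, Y′] = Y·Y′ − Y′·Y`, weighted by `[u′ = u] + [u′ + e_{λ′} = u]` (`rotLetter_bondLetter_site`);
* hence **`jet22_bgWard_point`**: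
  `4·[jet22(W; B + gaugeDir₀ λ) − jet22(W; B) − jet22(W; gaugeDir₀ λ)] + 4·[jet21(W + adj λ W; B) − jet21(W; B) − jet21(adj λ W; B)]`
  `   + 2·[u′ = u]·jet21(W; bondLetter u′ λ′ [Y,Y′]) + 2·[u′ + e_{λ′} = u]·jet21(W; bondLetter u′ λ′ [Y,Y′]) = 0`
  — the remainder of the second-order background Ward identity is the FIRST-ORDER Wilson table at the bond `(u′, λ′)` with the commutator
  letter, supported on the two endpoints of that bond; and **`jet22_bgWard_point_far`**: for `u ∉ {u′, u′ + e_{λ′}}` the polar identity holds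
  with NO remainder.

The stencil transcription (coordinates, colour stripping, `ℤ^{d+1}`) is NOT here.

NOT IN PRINT; OUR BOOKKEEPING (cell `pub-balaban`, β sub-cell, D1 formalisation swarm seat `b2b-balaban-beta-d1-formalise-leaf-09`, gen 3).
HONEST FRAMING (cell contract, verbatim): «discharging `BetaPertH` makes Bałaban's UV stability UNCONDITIONAL — a real constructive-QFT
result; it is NOT the continuum limit and NOT the Clay problem.»  HONEST DEPENDENCY (verbatim): «continuum YM on T⁴ ⇐ BetaPertH ∧ nine
spine estimates (0/9 proved); BetaPertH ⇐ (D1) ∧ (D4) ∧ CAP+tail; G-an2-4 gates asym, D1 and NE2/3/4.»  THIS FILE DISCHARGES NOTHING of the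
wall; [folklore] multilinear algebra; no binder of (D1) instantiated; not summit progress, not continuum, not Clay.  ABSOLUTE RULE (cell,
verbatim): «No internally-minted statement may enter as a cited fact. Every hypothesis is either kernel-proved in this package or a verbatim
quotation of a PUBLISHED theorem with page reference. The manuscript(s) under audit are NOT citable for their own disputed steps — they are
the thing under adjudication; programme-internal (2001/route/tribunal) claims are never citable.»  Nothing cited; no `def`; kernel-proved
from part 4 and an3's `PlaquetteBackground.jet21_add_bg` / `jet21_zero_bg` BY NAME.
-/

namespace Summit.QuantumFields.BalabanUV.Beta.WilsonBackgroundWard22Point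

open Literature.MathematicalPhysics.QuantumFieldTheory.Balaban1983to89.Beta.PlaquetteVertex (plaqWord jet21 bondLetter)
open Literature.MathematicalPhysics.QuantumFieldTheory.Balaban1983to89.Beta.PlaquetteVertex2 (jet22)
open Literature.MathematicalPhysics.QuantumFieldTheory.Balaban1983to89.Beta.PlaquetteBackground (jet21_add_bg jet21_zero_bg)
open Literature.MathematicalPhysics.QuantumFieldTheory.Balaban1983to89.Beta.WilsonWardJets (gaugeDir₀)
open Summit.QuantumFields.BalabanUV.Beta.WilsonJetDivergence (adj adj_apply)
open Summit.QuantumFields.BalabanUV.Beta.WilsonBackgroundWard22All (jet22_bgWard)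

section Letters

variable {𝔸 : Type*} [NormedRing 𝔸]
variable {Λ : Type*} [AddCommGroup Λ] [DecidableEq Λ] {D : Type*} [DecidableEq D]

omit [DecidableEq D] in
/-- [folklore] the pure-gauge background of the site-delta parameter `λ = [· = u]·Y` lives on the bonds touching `u`:
`gaugeDir₀ e λ x μ = [x = u]·Y − [x + e_μ = u]·Y`. -/
theorem gaugeDir₀_site (e : D → Λ) (u : Λ) (Y : 𝔸) (x : Λ) (μ : D) :
    gaugeDir₀ e (fun y => if y = u then Y else 0) x μ = (if x = u then Y else 0) - (if x + e μ = u then Y else 0) := rfl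

omit [AddCommGroup Λ] [DecidableEq D] in
/-- [folklore] the base-point conjugation by the site-delta parameter acts on the bonds starting at `u` only:
`adj λ W x k = [x = u]·(Y·W x k − W x k·Y)`. -/
theorem adj_site (u : Λ) (Y : 𝔸) (W : Λ → D → 𝔸) (x : Λ) (k : D) :
    adj (fun y => if y = u then Y else 0) W x k = if x = u then Y * W x k - W x k * Y else 0 := by
  rw [adj_apply]
  split_ifs
  · rfl
  · rw [zero_mul, mul_zero, sub_zero]

omit [AddCommGroup Λ] in
/-- [folklore] the one-bond field with the zero letter is the zero field. -/
theorem bondLetter_zero (z : Λ) (γ : D) : bondLetter z γ (0 : 𝔸) = 0 := by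
  funext y δ
  simp only [bondLetter, ite_self, Pi.zero_apply]

omit [AddCommGroup Λ] in
/-- [folklore] a conditional letter on a bond is the conditional one-bond field. -/
theorem bondLetter_ite (z : Λ) (γ : D) (P : Prop) [Decidable P] (Z : 𝔸) :
    bondLetter z γ (if P then Z else 0) = if P then bondLetter z γ Z else 0 := by
  split_ifs
  · rfl
  · exact bondLetter_zero z γ

/-- [folklore] **THE ROTATED LETTER COLLAPSES ONTO THE BACKGROUND BOND.**  For `λ = [· = u]·Y` and `B = bondLetter u′ λ′ Y′`, part 4's
endpoint-sum conjugation `(λ(b₋) + λ(b₊))·B_b − B_b·(λ(b₋) + λ(b₊))` is the one-bond field at `(u′, λ′)` with letter `[Y, Y′]`, once for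
each endpoint of the bond that equals `u`. -/
theorem rotLetter_bondLetter_site (e : D → Λ) (u : Λ) (Y : 𝔸) (u' : Λ) (lam' : D) (Y' : 𝔸) :
    (fun y δ => ((if y = u then Y else 0) + (if y + e δ = u then Y else 0)) * bondLetter u' lam' Y' y δ
        - bondLetter u' lam' Y' y δ * ((if y = u then Y else 0) + (if y + e δ = u then Y else 0))) =
      bondLetter u' lam' (if u' = u then Y * Y' - Y' * Y else 0) +
        bondLetter u' lam' (if u' + e lam' = u then Y * Y' - Y' * Y else 0) := by
  funext y δ
  simp only [bondLetter, Pi.add_apply]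
  by_cases h : y = u' ∧ δ = lam'
  · obtain ⟨rfl, rfl⟩ := h
    simp only [and_self, if_true]
    split_ifs <;> noncomm_ring
  · simp only [h, if_false, mul_zero, zero_mul, sub_zero, add_zero]

end Letters

section Lattice

variable (𝕜 : Type*) [RCLike 𝕜] {𝔸 : Type*} [NormedRing 𝔸] [NormedAlgebra 𝕜 𝔸]
variable {V : Type*} [AddCommGroup V] [Module 𝕜 V]
variable {Λ : Type*} [Fintype Λ] [AddCommGroup Λ] [DecidableEq Λ] {D : Type*} [Fintype D] [DecidableEq D]

omit [DecidableEq Λ] [DecidableEq D] in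
/-- [folklore] the `(2,1)`-jet against a conditional background is the conditional jet (tracial `τ`; `jet21_zero_bg`). -/
theorem jet21_ite_bg (τ : 𝔸 →ₗ[𝕜] V) (hτ : ∀ a b : 𝔸, τ (a * b) = τ (b * a)) (e : D → Λ) (W : Λ → D → 𝔸) (P : Prop) [Decidable P]
    (B : Λ → D → 𝔸) :
    jet21 𝕜 τ e W (if P then B else 0) = if P then jet21 𝕜 τ e W B else 0 := by
  split_ifs
  · rfl
  · exact jet21_zero_bg 𝕜 τ hτ e W

/-- [folklore] **THE SECOND-ORDER BACKGROUND WARD IDENTITY, POINT FORM.**  For every finite lattice `Λ` with frame `e`, tracial `τ`,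
fluctuation `W`, site `u` with gauge letter `Y` and background bond `(u′, λ′)` with letter `Y′`:
`4·[jet22(W; B + gaugeDir₀ λ) − jet22(W; B) − jet22(W; gaugeDir₀ λ)] + 4·[jet21(W + adj λ W; B) − jet21(W; B) − jet21(adj λ W; B)]`
`  + (2·[u′ = u]·jet21(W; bondLetter u′ λ′ [Y,Y′]) + 2·[u′ + e_{λ′} = u]·jet21(W; bondLetter u′ λ′ [Y,Y′])) = 0`,
`λ = [· = u]·Y`, `B = bondLetter u′ λ′ Y′`, `[Y,Y′] = Y·Y′ − Y′·Y` — part 4's `jet22_bgWard` with the rotated letter collapsed by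
`rotLetter_bondLetter_site`: the remainder is the FIRST-ORDER table of the background bond with the commutator letter, supported on the
bond's two endpoints. -/
theorem jet22_bgWard_point (τ : 𝔸 →ₗ[𝕜] V) (hτ : ∀ a b : 𝔸, τ (a * b) = τ (b * a)) (e : D → Λ) (W : Λ → D → 𝔸) (u : Λ) (Y : 𝔸)
    (u' : Λ) (lam' : D) (Y' : 𝔸) :
    (4 : 𝕜) • jet22 𝕜 τ e W (bondLetter u' lam' Y' + gaugeDir₀ e (fun y => if y = u then Y else 0))
        - (4 : 𝕜) • jet22 𝕜 τ e W (bondLetter u' lam' Y') - (4 : 𝕜) • jet22 𝕜 τ e W (gaugeDir₀ e (fun y => if y = u then Y else 0))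
      + ((4 : 𝕜) • jet21 𝕜 τ e (W + adj (fun y => if y = u then Y else 0) W) (bondLetter u' lam' Y')
          - (4 : 𝕜) • jet21 𝕜 τ e W (bondLetter u' lam' Y')
          - (4 : 𝕜) • jet21 𝕜 τ e (adj (fun y => if y = u then Y else 0) W) (bondLetter u' lam' Y'))
      + ((2 : 𝕜) • (if u' = u then jet21 𝕜 τ e W (bondLetter u' lam' (Y * Y' - Y' * Y)) else 0)
          + (2 : 𝕜) • (if u' + e lam' = u then jet21 𝕜 τ e W (bondLetter u' lam' (Y * Y' - Y' * Y)) else 0)) = 0 := by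
  have h := jet22_bgWard 𝕜 τ hτ e W (bondLetter u' lam' Y') (fun y => if y = u then Y else 0)
  rw [rotLetter_bondLetter_site, jet21_add_bg 𝕜 τ hτ, bondLetter_ite, bondLetter_ite, jet21_ite_bg 𝕜 τ hτ, jet21_ite_bg 𝕜 τ hτ,
    smul_add] at h
  exact h

/-- [folklore] **AWAY FROM THE BACKGROUND BOND THERE IS NO REMAINDER**: if `u ≠ u′` and `u ≠ u′ + e_{λ′}` the polar identity
`4·[jet22(W; B + gaugeDir₀ λ) − jet22(W; B) − jet22(W; gaugeDir₀ λ)] + 4·[jet21(W + adj λ W; B) − jet21(W; B) − jet21(adj λ W; B)] = 0` holds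
exactly (`λ = [· = u]·Y`, `B = bondLetter u′ λ′ Y′`). -/
theorem jet22_bgWard_point_far (τ : 𝔸 →ₗ[𝕜] V) (hτ : ∀ a b : 𝔸, τ (a * b) = τ (b * a)) (e : D → Λ) (W : Λ → D → 𝔸) (u : Λ) (Y : 𝔸)
    (u' : Λ) (lam' : D) (Y' : 𝔸) (hu : u' ≠ u) (hu' : u' + e lam' ≠ u) :
    (4 : 𝕜) • jet22 𝕜 τ e W (bondLetter u' lam' Y' + gaugeDir₀ e (fun y => if y = u then Y else 0))
        - (4 : 𝕜) • jet22 𝕜 τ e W (bondLetter u' lam' Y') - (4 : 𝕜) • jet22 𝕜 τ e W (gaugeDir₀ e (fun y => if y = u then Y else 0))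
      + ((4 : 𝕜) • jet21 𝕜 τ e (W + adj (fun y => if y = u then Y else 0) W) (bondLetter u' lam' Y')
          - (4 : 𝕜) • jet21 𝕜 τ e W (bondLetter u' lam' Y')
          - (4 : 𝕜) • jet21 𝕜 τ e (adj (fun y => if y = u then Y else 0) W) (bondLetter u' lam' Y')) = 0 := by
  have h := jet22_bgWard_point 𝕜 τ hτ e W u Y u' lam' Y'
  rw [if_neg hu, if_neg hu', smul_zero, add_zero, add_zero] at h
  exact h

/-- [folklore] **COMMUTING LETTERS GIVE NO REMAINDER EITHER**: if `Y·Y′ = Y′·Y` (e.g. an abelian structure algebra, or `Y′` in the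
centraliser of `Y`) the polar identity holds exactly at every site. -/
theorem jet22_bgWard_point_comm (τ : 𝔸 →ₗ[𝕜] V) (hτ : ∀ a b : 𝔸, τ (a * b) = τ (b * a)) (e : D → Λ) (W : Λ → D → 𝔸) (u : Λ) (Y : 𝔸)
    (u' : Λ) (lam' : D) (Y' : 𝔸) (hc : Y * Y' = Y' * Y) :
    (4 : 𝕜) • jet22 𝕜 τ e W (bondLetter u' lam' Y' + gaugeDir₀ e (fun y => if y = u then Y else 0))
        - (4 : 𝕜) • jet22 𝕜 τ e W (bondLetter u' lam' Y') - (4 : 𝕜) • jet22 𝕜 τ e W (gaugeDir₀ e (fun y => if y = u then Y else 0))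
      + ((4 : 𝕜) • jet21 𝕜 τ e (W + adj (fun y => if y = u then Y else 0) W) (bondLetter u' lam' Y')
          - (4 : 𝕜) • jet21 𝕜 τ e W (bondLetter u' lam' Y')
          - (4 : 𝕜) • jet21 𝕜 τ e (adj (fun y => if y = u then Y else 0) W) (bondLetter u' lam' Y')) = 0 := by
  have h := jet22_bgWard_point 𝕜 τ hτ e W u Y u' lam' Y'
  rw [hc, sub_self, bondLetter_zero, jet21_zero_bg 𝕜 τ hτ, ite_self, ite_self, smul_zero, add_zero, add_zero] at h
  exact h

end Lattice

end Summit.QuantumFields.BalabanUV.Beta.WilsonBackgroundWard22Point
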